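import Literature.AlgebraicGeometry.HodgeTheory.WeilClassesFieldIntersections
import Literature.AlgebraicGeometry.HodgeTheory.WeilClassesFieldProductsOrthogonal
import Literature.AlgebraicGeometry.Milne1999.CentraliserFixesDivisorClasses
import Literature.AlgebraicGeometry.Milne1999.SpecialLefschetzGroupInvariantsProducts
import HarnessLib

/-!
# Weil classes of a product `A₁ × A₂` with `2 dim A₁ / [F:ℚ]` odd are exceptional: `W_F(A₁ × A₂) ⊗ ℂ ∩ Dᵐ ⊗ ℂ = 0`
# (Moonen–Zarhin 1998, §2 Example, on the carriers, via the involution `(-1) ⊕ 1` of the Lefschetz group)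

Layer `Literature/AlgebraicGeometry/HodgeTheory`, theorem-only junction of the seat's `WeilClassesFieldProductsOrthogonal`
(Moonen–Zarhin §2: `W_F(Y₁ × Y₂) = W_F(Y₁) ⊗_F W_F(Y₂)` inside the Künneth component, complexified as a containment) and
`WeilClassesFieldIntersections` / `WeilClassesFieldAllOrNothing` (the dichotomies of §1) with the tree's Milne 1999 layer:
`S(A)(ℂ) = Milne1999.unitaryCentralizerGroup A h`, the element `s ⊕ t ∈ S(A₁ × A₂)(ℂ)` for Hom-orthogonal factors
(`Milne1999.prodBlockDiagEquiv_mem_unitaryCentralizerGroup`, Milne Prop. 1.5), `-1 ∈ S(A)(ℂ)` acting by `(-1)ᵏ` on `Hᵏ`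
(`Milne1999.neg_mem_unitaryCentralizerGroup`, `Milne1999.exteriorPullback_neg`, Milne p. 657), and Milne's Thm. 4.4 «any
`γ ∈ G(A)` will fix all divisor classes» (`Milne1999.exteriorPullback_eq_self_of_mem_divisorClassesSpan_of_nondegenerate`).
Everything is proved; no definition, no named fact.

PRINTED STATEMENT.  B. J. J. Moonen – Yu. G. Zarhin, *Weil classes on abelian varieties*, J. reine angew. Math. 496
(1998) 83–92 = arXiv:alg-geom/9612017 (held text `paper:arxiv-alg-geom_9612017`), §2 (chunk p0002, lines 1–13): «The
condition that `1 ∈ F` acts as the identity implies that `F` acts on each factor `Yᵢ^{mᵢ}`, and that the action of `F` on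
`X` is the “diagonal action” … Write `rᵢ = 2mᵢ dim(Yᵢ)/[F:ℚ]`, so that `r = r₁ + ⋯ + r_k` … the space `W_F(X)` can be
identified with the tensor product `W_F(Y₁^{m₁}) ⊗_F … ⊗_F W_F(Y_k^{m_k})`, considered as a subspace of the Künneth
component»; and the EXAMPLE (chunk p0002, lines 33–38): «Let `X = Y₁ × Y₂` where the ratios `2dim(Y₁)/[F:ℚ]` and
`2dim(Y₂)/[F:ℚ]` are odd.  Then non-zero elements of `W_F(Y₁)` and `W_F(Y₂)` are not Hodge classes and therefore all
non-zero elements of `W_F(X)` are exceptional Hodge classes.  Shioda's example mentioned above is of this type.»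
(«exceptional» = not in `D^•(X)`, the subalgebra of `B^•(X)` generated by divisor classes, §1 chunk p0001.)

RENDERING AND ROUTE.  `Y₁`, `Y₂` «simple, non-isogenous» enters only through HOM-ORTHOGONALITY (`Hom(A₁, A₂) = 0 =
Hom(A₂, A₁)`), under which every `Ψ ∈ End(A₁ × A₂)` is diagonal and `P(Ψ) = 0` descends to the corners
(`WeilClassesFieldProductsOrthogonal`).  Moonen–Zarhin deduce the Example from the displayed equivalence «`W_F(X)`
decomposable ⟺ each `W_F(Yᵢ^{mᵢ})` decomposable», whose proof uses `NS(Y₁ × Y₂) = NS(Y₁) ⊕ NS(Y₂)`; the tree has that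
splitting only at torus level, so this file takes the (shorter) road through the Lefschetz group, which is Moonen–Zarhin's
own mechanism of §1 (proof of Criterion (2): an element of `G_div(X)` acting on `W_F ⊗ ℂ` by `-1`): the involution
`ι = (-1) ⊕ 1` of `H¹(A₁ × A₂) = H¹(A₁) ⊕ H¹(A₂)` lies in `S(A₁ × A₂)(ℂ)` (for the product polarization class
`pr₁^* h₁ + pr₂^* h₂` of polarization classes of the factors), `⋀^{r₁+r₂}ι` acts on `pr₁^* a ∪ pr₂^* b` (`a ∈ H^{r₁}(A₁)`,
`b ∈ H^{r₂}(A₂)`) by `(-1)^{r₁}`, hence by `-1` on `W_F(A₁ × A₂) ⊗ ℂ` when `r₁` is odd, and by `+1` on `Dᵐ ⊗ ℂ` (Milne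
Thm. 4.4) — so `W_F ⊗ ℂ ∩ Dᵐ ⊗ ℂ = 0`.  (That «non-zero elements of `W_F(Yᵢ)` are not Hodge classes» for odd `rᵢ` is the
parity of the degree and is not restated.)

WHAT IS PROVED.  `A₁`, `A₂` complex abelian varieties with `∀ f : A₁ ⟶ A₂, f = 0` and `∀ g : A₂ ⟶ A₁, g = 0`;
`Ψ ∈ End(A₁ × A₂)`; `P ∈ ℤ[T]` monic, irreducible over `ℚ`, of degree `e`, with `P(Ψ) = 0`; `e · r₁ = 2 dim A₁`,
`e · r₂ = 2 dim A₂`.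
* §1 `exteriorPullback_prodBlockDiagEquiv_neg_one_cupProduct` — `⋀ᵏ((-1) ⊕ 1) (pr₁^* x ∪ pr₂^* y) = (-1)ⁱ (pr₁^* x ∪ pr₂^* y)`
  for `x ∈ Hⁱ(A₁)`, `y ∈ Hʲ(A₂)` (any `A₁`, `A₂`); **`exteriorPullback_prodBlockDiagEquiv_neg_one_eq_neg_of_mem_
  weilClassesField_prod`** — for `r₁` odd, `⋀^{r₁+r₂}((-1) ⊕ 1) c = -c` for every `c ∈ W_F(A₁ × A₂, Ψ) ⊗ ℂ`.
* §2 `inf_divisorClassesSpan_eq_bot_of_forall_exteriorPullback_eq_smul` — on any complex abelian variety `A` with a class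
  `h ∈ B¹ ⊗ ℂ` whose pairing `Q_h` is non-degenerate on `H¹`: a subspace `M ⊆ H²ᵖ(A(ℂ); ℂ)` on which `⋀²ᵖu` acts by a
  scalar `κ ≠ 1` for some `u ∈ S(A)(ℂ)` meets `Dᵖ ⊗ ℂ` in `0`.
* §3 **`weilClassesField_prod_inf_divisorClassesSpan_eq_bot_of_odd`** — `r₁` odd, `r₁ + r₂ = 2m` ⟹
  `W_F(A₁ × A₂, Ψ) ⊗ ℂ ⊓ Dᵐ(A₁ × A₂) ⊗ ℂ = ⊥`; `not_mem_divisorClassesSpan_of_mem_weilClassesField_prod_of_odd` — every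
  non-zero (complex) Weil class of the product is exceptional.
* §4 When the multiplicities of `Ψ` are balanced (`n_ρ = n_ρ̄` at every complex root — equivalently `W_F ⊗ ℂ` consists of
  Hodge classes, `forall_isOfHodgeType_weilClassesField_iff_balanced`; Moonen–Zarhin's standing «if `W_F(X)` consists of
  Hodge classes»): **`exists_isRationalClass_isOfHodgeType_not_mem_divisorClassesSpan_prod_of_odd`** — there is a non-zero
  RATIONAL Hodge class of type `(m, m)` in `W_F(A₁ × A₂)` outside `Dᵐ ⊗ ℂ` (an exceptional Hodge class);
  `forall_isOfHodgeType_and_not_mem_divisorClassesSpan_of_mem_weilClassesField_prod_of_odd` — «all non-zero elements of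
  `W_F(X)` are exceptional Hodge classes»; `natDegree_le_finrank_hodgeClassSpan_sub_finrank_divisorClassesSpan_prod_of_odd`
  — `[F:ℚ] ≤ dim_ℂ Bᵐ ⊗ ℂ − dim_ℂ Dᵐ ⊗ ℂ` on `A₁ × A₂`; `not_isDivisorGenerated_prod_of_odd` — `B^•(A₁ × A₂) ≠ D^•(A₁ × A₂)`.

Honesty clause: an exceptionality statement for a CLASS of pairs `(A₁ × A₂, Ψ)` given by hypotheses — no particular
abelian variety is constructed here and the existence of such pairs (Shioda's example, [SZ2]) is not formalized; no Weil
class is proved algebraic or non-algebraic; nothing about the Hodge conjecture for these products is claimed either way.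
No `sorry`; axioms `propext`, `Classical.choice`, `Quot.sound`.

## References
* [MoonenZarhin1998WeilClasses] B. J. J. Moonen, Yu. G. Zarhin, *Weil classes on abelian varieties*, J. reine angew.
  Math. 496 (1998) 83–92 = arXiv:alg-geom/9612017, §1 (exceptional classes, `G_div(X)`, proof of Criterion (2)) and §2
  (first paragraph and Example; chunk p0002).
* [Milne1999LefschetzClasses] J. S. Milne, *Lefschetz classes on abelian varieties*, Duke Math. J. 96 (1999) 639–675, §1
  p. 643–644 (`S(A)`, products, Prop. 1.5), §3 p. 657 (`μ₂ ⊆ S(A)`, `-1` acts by `(-1)ⁱ` on `Hⁱ`), Thm. 4.4 (p. 659).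
* [vanGeemen1994HodgeAV] B. van Geemen, *An introduction to the Hodge conjecture for abelian varieties*, LNM 1594 (1994),
  2.4–2.5 (the spaces `Dᵖ ⊆ Bᵖ`, exceptional classes), 6.12.
* [HatcherAT2002] A. Hatcher, *Algebraic Topology* (2002), §3.2 Prop. 3.10, Thm. 3.16 (Künneth, cross products).
-/

noncomputable section

open CategoryTheory Polynomial Module

namespace Literature.AlgebraicGeometry.HodgeTheory

open Literature.AlgebraicGeometry.Motives
open Literature.AlgebraicGeometry.VanGeemen1994 (hodgeClassSpan)
open Literature.AlgebraicGeometry.Milne1999 (unitaryCentralizerGroup prodBlockDiagEquiv prodPolarizationClass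
  exteriorPullback_eq_self_of_mem_divisorClassesSpan_of_nondegenerate neg_mem_unitaryCentralizerGroup exteriorPullback_neg
  prodBlockDiagEquiv_mem_unitaryCentralizerGroup exteriorPullback_prodBlockDiagEquiv_cross exists_polarizationClass
  prodPolarizationClass_mem_hodgeClassSpan eq_zero_of_forall_polarizationPairingOne_prod_eq_zero exteriorPullback_id)
open Literature.AlgebraicGeometry.Milne1999.CMTypeProducts (cornerFst cornerSnd)
open Literature.AlgebraicTopology.SingularHomology
open Literature.Barriers.HodgeConjecture (divisorClassesSpan)

section HodgeTheory

variable {A₁ A₂ : AbelianVariety ℂ} {Ψ : A₁.prod A₂ ⟶ A₁.prod A₂} {P : Polynomial ℤ} {e r₁ r₂ m : ℕ}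

/-! ### §1 The involution `ι = (-1) ⊕ 1` of `H¹(A₁ × A₂)` acts by `(-1)^{r₁}` on `pr₁^* H^{r₁}(A₁) ∪ pr₂^* H^{r₂}(A₂)` -/

section Involution

/-- **`⋀ᵏ((-1) ⊕ 1) (pr₁^* x ∪ pr₂^* y) = (-1)ⁱ · (pr₁^* x ∪ pr₂^* y)`** for `x ∈ Hⁱ(A₁(ℂ); ℂ)`, `y ∈ Hʲ(A₂(ℂ); ℂ)`,
`i + j = k`: the Künneth step `⋀ᵏ(s ⊕ t)(pr₁^* x ∪ pr₂^* y) = pr₁^*(⋀ⁱs x) ∪ pr₂^*(⋀ʲt y)` with `⋀ⁱ(-1) = (-1)ⁱ` and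
`⋀ʲ1 = 1` (Milne p. 657: «`−1 ∈ μ₂(ℚ)` acts as multiplication by `(−1)ⁱ` on `Hⁱ`»).
[cite: Milne1999LefschetzClasses, §3 p. 657 and §1 p. 643] [cite: HatcherAT2002, §3.2 Prop. 3.10, Thm. 3.16] -/
theorem exteriorPullback_prodBlockDiagEquiv_neg_one_cupProduct {i j k : ℕ} (hk : i + j = k)
    (x : complexBetti A₁.X i) (y : complexBetti A₂.X j) :
    exteriorPullback (AbelianVariety.hasExteriorCohomologyH1_complexPoints (A₁.prod A₂))
        (prodBlockDiagEquiv (LinearEquiv.neg ℂ) (1 : complexBetti A₂.X 1 ≃ₗ[ℂ] complexBetti A₂.X 1)).toLinearMap k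
        (cupProduct hk (complexBetti.map (AbelianVariety.fst A₁ A₂).hom.hom.hom i x)
          (complexBetti.map (AbelianVariety.snd A₁ A₂).hom.hom.hom j y)) =
      ((-1 : ℂ) ^ i) • cupProduct hk (complexBetti.map (AbelianVariety.fst A₁ A₂).hom.hom.hom i x)
          (complexBetti.map (AbelianVariety.snd A₁ A₂).hom.hom.hom j y) := by
  rw [exteriorPullback_prodBlockDiagEquiv_cross,
    show (1 : complexBetti A₂.X 1 ≃ₗ[ℂ] complexBetti A₂.X 1).toLinearMap = LinearMap.id from rfl,
    exteriorPullback_id, LinearMap.id_apply,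
    show (LinearEquiv.neg ℂ : complexBetti A₁.X 1 ≃ₗ[ℂ] complexBetti A₁.X 1).toLinearMap =
      ((LinearEquiv.neg ℂ : complexBetti A₁.X 1 ≃ₗ[ℂ] complexBetti A₁.X 1) :
        complexBetti A₁.X 1 →ₗ[ℂ] complexBetti A₁.X 1) from rfl,
    exteriorPullback_neg, map_smul, LinearMap.map_smul₂]

/-- **`⋀^{r₁+r₂}((-1) ⊕ 1) = -1` ON `W_F(A₁ × A₂) ⊗ ℂ` WHEN `r₁ = 2 dim A₁ / [F:ℚ]` IS ODD** (Hom-orthogonal factors,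
`P(Ψ) = 0`, `e · rᵢ = 2 dim Aᵢ`): `W_F(A₁ × A₂) ⊗ ℂ` is spanned by products `pr₁^* a ∪ pr₂^* b` of Weil classes of the
factors (Moonen–Zarhin §2, `W_F(X) = W_F(Y₁) ⊗_F W_F(Y₂)` — the tree's
`weilClassesField_prod_le_span_cupProduct_of_orthogonal`), on which the involution acts by `(-1)^{r₁} = -1` — the
mechanism of Moonen–Zarhin's proof of Criterion (2) («acts on `W_F ⊗ ℂ` as multiplication by `(−1)^{…}`»).
[cite: MoonenZarhin1998WeilClasses, §2 first paragraph and Example (chunk p0002), §1 proof of Criterion (2)]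
[cite: Milne1999LefschetzClasses, §3 p. 657] -/
theorem exteriorPullback_prodBlockDiagEquiv_neg_one_eq_neg_of_mem_weilClassesField_prod
    (hAB : ∀ f : A₁ ⟶ A₂, f = 0) (hBA : ∀ g : A₂ ⟶ A₁, g = 0) (hPm : P.Monic) (hPe : P.natDegree = e)
    (hPirr : Irreducible (P.map (Int.castRingHom ℚ)))
    (hΨ : Polynomial.eval₂ (Int.castRingHom (CategoryTheory.End (A₁.prod A₂)))
      (Ψ : CategoryTheory.End (A₁.prod A₂)) P = 0)
    (her₁ : e * r₁ = 2 * A₁.dim) (her₂ : e * r₂ = 2 * A₂.dim) (hr₁ : Odd r₁) {k : ℕ} (hk : r₁ + r₂ = k)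
    {c : complexBetti (A₁.prod A₂).X k} (hc : c ∈ weilClassesField (A₁.prod A₂) Ψ P k) :
    exteriorPullback (AbelianVariety.hasExteriorCohomologyH1_complexPoints (A₁.prod A₂))
        (prodBlockDiagEquiv (LinearEquiv.neg ℂ) (1 : complexBetti A₂.X 1 ≃ₗ[ℂ] complexBetti A₂.X 1)).toLinearMap k
        c = -c := by
  have hc' := weilClassesField_prod_le_span_cupProduct_of_orthogonal hAB hBA hPm hPe hPirr hΨ her₁ her₂ hk hc
  clear hc
  induction hc' using Submodule.span_induction with
  | mem x hx =>
    obtain ⟨a, -, b, -, rfl⟩ := hx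
    rw [exteriorPullback_prodBlockDiagEquiv_neg_one_cupProduct, hr₁.neg_one_pow, neg_one_smul]
  | zero => rw [map_zero, neg_zero]
  | add x y _ _ hx hy => rw [map_add, hx, hy, neg_add]
  | smul t x _ hx => rw [map_smul, hx, smul_neg]

end Involution

/-! ### §2 A subspace on which some `⋀u`, `u ∈ S(A)(ℂ)`, acts by a scalar `≠ 1` meets `Dᵖ ⊗ ℂ` in `0` -/

section Scalar

/-- **An eigenvalue `κ ≠ 1` of `S(A)(ℂ)` excludes divisor classes**: let `h ∈ B¹(A) ⊗ ℂ` have a non-degenerate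
pairing `Q_h` on `H¹` (a polarization class) and `u ∈ S(A)(ℂ) = unitaryCentralizerGroup A h`.  If `⋀²ᵖu` acts on a
subspace `M ⊆ H²ᵖ(A(ℂ); ℂ)` as the scalar `κ ≠ 1`, then `M ∩ Dᵖ ⊗ ℂ = 0` — for `⋀²ᵖu` fixes every class of `Dᵖ ⊗ ℂ`
(Milne Thm. 4.4: «any `γ ∈ G(A)` will fix all divisor classes»; Moonen–Zarhin: `G_div(X)` «leaves invariant all divisor
classes»). [cite: Milne1999LefschetzClasses, Thm. 4.4 (p. 659)] [cite: MoonenZarhin1998WeilClasses, §1 (G_div(X),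
chunk p0002 lines 60–66) and proof of Criterion (2)] -/
theorem inf_divisorClassesSpan_eq_bot_of_forall_exteriorPullback_eq_smul {A : AbelianVariety ℂ}
    {h : complexBetti A.X 2} (hh : h ∈ hodgeClassSpan A.dim A.X 1)
    (hnd : ∀ x : complexBetti A.X 1, (∀ y, polarizationPairingOne A.X h (A.dim - 1) x y = 0) → x = 0)
    {u : complexBetti A.X 1 ≃ₗ[ℂ] complexBetti A.X 1} (hu : u ∈ unitaryCentralizerGroup A h) {p : ℕ}
    {M : Submodule ℂ (complexBetti A.X (2 * p))} {κ : ℂ} (hκ : κ ≠ 1)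
    (hM : ∀ c ∈ M, exteriorPullback (AbelianVariety.hasExteriorCohomologyH1_complexPoints A)
      (u : complexBetti A.X 1 →ₗ[ℂ] complexBetti A.X 1) (2 * p) c = κ • c) :
    M ⊓ divisorClassesSpan A.X A.dim p = ⊥ := by
  rw [Submodule.eq_bot_iff]
  rintro c ⟨hcM, hcD⟩
  have hc := hM c hcM
  rw [exteriorPullback_eq_self_of_mem_divisorClassesSpan_of_nondegenerate hh hnd hu p hcD] at hc
  -- `c = κ • c` with `κ ≠ 1` forces `c = 0`
  have h0 : (κ - 1) • c = 0 := by rw [sub_smul, one_smul, ← hc, sub_self]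
  exact (smul_eq_zero.1 h0).resolve_left (sub_ne_zero.2 hκ)

end Scalar

/-! ### §3 The Example: `W_F(A₁ × A₂) ⊗ ℂ ∩ Dᵐ ⊗ ℂ = 0` for `r₁` odd -/

section Example

/-- `0 < e` for `P` irreducible over `ℚ` of degree `e`. [folklore] -/
private theorem natDegree_pos_of_irreducible_map (hPe : P.natDegree = e)
    (hPirr : Irreducible (P.map (Int.castRingHom ℚ))) : 0 < e := by
  rw [← hPe, ← natDegree_map_eq_of_injective (RingHom.injective_int (Int.castRingHom ℚ)) P]
  exact natDegree_pos_iff_degree_pos.2 (degree_pos_of_irreducible hPirr)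

/-- **MOONEN–ZARHIN'S EXAMPLE: `W_F(A₁ × A₂) ⊗ ℂ ⊓ Dᵐ(A₁ × A₂) ⊗ ℂ = ⊥` WHEN `2 dim A₁ / [F:ℚ]` IS ODD.**  For
Hom-orthogonal complex abelian varieties `A₁`, `A₂` («`Y₁`, `Y₂` simple, non-isogenous»), `Ψ ∈ End(A₁ × A₂)` with
`P(Ψ) = 0` (`P` monic irreducible of degree `e = [F:ℚ]`, `F = ℚ(Ψ)`), `e · rᵢ = 2 dim Aᵢ`, `r₁` odd and `r₁ + r₂ = 2m`:
no non-zero complexified Weil class of `(A₁ × A₂, Ψ)` lies in the span of products of `m` divisor classes.  Proof: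
the involution `ι = (-1) ⊕ 1 ∈ S(A₁ × A₂)(ℂ)` (for the product `pr₁^* h₁ + pr₂^* h₂` of polarization classes of the
factors, Milne Prop. 1.5) acts by `-1` on `W_F ⊗ ℂ` (§1) and by `+1` on `Dᵐ ⊗ ℂ` (Milne Thm. 4.4), §2.
[cite: MoonenZarhin1998WeilClasses, §2 Example (chunk p0002, lines 33–38): «all non-zero elements of W_F(X) are
exceptional»] [cite: Milne1999LefschetzClasses, §1 p. 643, Prop. 1.5, §3 p. 657, Thm. 4.4] -/
theorem weilClassesField_prod_inf_divisorClassesSpan_eq_bot_of_odd (hAB : ∀ f : A₁ ⟶ A₂, f = 0)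
    (hBA : ∀ g : A₂ ⟶ A₁, g = 0) (hPm : P.Monic) (hPe : P.natDegree = e)
    (hPirr : Irreducible (P.map (Int.castRingHom ℚ)))
    (hΨ : Polynomial.eval₂ (Int.castRingHom (CategoryTheory.End (A₁.prod A₂)))
      (Ψ : CategoryTheory.End (A₁.prod A₂)) P = 0)
    (her₁ : e * r₁ = 2 * A₁.dim) (her₂ : e * r₂ = 2 * A₂.dim) (hr₁ : Odd r₁) (hk : r₁ + r₂ = 2 * m) :
    weilClassesField (A₁.prod A₂) Ψ P (2 * m) ⊓ divisorClassesSpan (A₁.prod A₂).X (A₁.prod A₂).dim m = ⊥ := by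
  -- both factors are positive-dimensional (`r₁`, `r₂` are odd, `e > 0`)
  have he : 0 < e := natDegree_pos_of_irreducible_map hPe hPirr
  have hodd := Nat.odd_iff.1 hr₁
  have hA₁0 : 0 < A₁.dim := by
    have h1 : 0 < e * r₁ := Nat.mul_pos he hr₁.pos
    omega
  have hA₂0 : 0 < A₂.dim := by
    have h2 : 0 < e * r₂ := Nat.mul_pos he (by omega)
    omega
  -- polarization classes of the factors and the involution `(-1) ⊕ 1 ∈ S(A₁ × A₂)(ℂ)`
  obtain ⟨h₁, -, -, hh₁, h₁top, hnd₁⟩ := exists_polarizationClass A₁ hA₁0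
  obtain ⟨h₂, -, -, hh₂, h₂top, hnd₂⟩ := exists_polarizationClass A₂ hA₂0
  have hι : prodBlockDiagEquiv (LinearEquiv.neg ℂ) (1 : complexBetti A₂.X 1 ≃ₗ[ℂ] complexBetti A₂.X 1) ∈
      unitaryCentralizerGroup (A₁.prod A₂) (prodPolarizationClass A₁ A₂ h₁ h₂) :=
    prodBlockDiagEquiv_mem_unitaryCentralizerGroup hAB hBA h₁top h₂top neg_mem_unitaryCentralizerGroup
      (Subgroup.one_mem _)
  refine inf_divisorClassesSpan_eq_bot_of_forall_exteriorPullback_eq_smul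
    (prodPolarizationClass_mem_hodgeClassSpan h₁ h₂ hh₁ hh₂)
    (eq_zero_of_forall_polarizationPairingOne_prod_eq_zero h₁ h₂ hA₁0 hA₂0 h₁top h₂top hnd₁ hnd₂) hι
    (show (-1 : ℂ) ≠ 1 by norm_num) fun c hc => ?_
  rw [neg_one_smul]
  exact exteriorPullback_prodBlockDiagEquiv_neg_one_eq_neg_of_mem_weilClassesField_prod hAB hBA hPm hPe hPirr hΨ
    her₁ her₂ hr₁ hk hc

/-- **Every non-zero Weil class of `(A₁ × A₂, Ψ)` is exceptional** (`r₁` odd): a non-zero class of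
`W_F(A₁ × A₂) ⊗ ℂ` does not lie in `Dᵐ ⊗ ℂ`. [cite: MoonenZarhin1998WeilClasses, §2 Example (chunk p0002, lines 33–38)] -/
theorem not_mem_divisorClassesSpan_of_mem_weilClassesField_prod_of_odd (hAB : ∀ f : A₁ ⟶ A₂, f = 0)
    (hBA : ∀ g : A₂ ⟶ A₁, g = 0) (hPm : P.Monic) (hPe : P.natDegree = e)
    (hPirr : Irreducible (P.map (Int.castRingHom ℚ)))
    (hΨ : Polynomial.eval₂ (Int.castRingHom (CategoryTheory.End (A₁.prod A₂)))
      (Ψ : CategoryTheory.End (A₁.prod A₂)) P = 0)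
    (her₁ : e * r₁ = 2 * A₁.dim) (her₂ : e * r₂ = 2 * A₂.dim) (hr₁ : Odd r₁) (hk : r₁ + r₂ = 2 * m)
    {c : complexBetti (A₁.prod A₂).X (2 * m)} (hcW : c ∈ weilClassesField (A₁.prod A₂) Ψ P (2 * m))
    (hc0 : c ≠ 0) : c ∉ divisorClassesSpan (A₁.prod A₂).X (A₁.prod A₂).dim m := by
  intro hcD
  have h0 : c ∈ weilClassesField (A₁.prod A₂) Ψ P (2 * m) ⊓
      divisorClassesSpan (A₁.prod A₂).X (A₁.prod A₂).dim m := ⟨hcW, hcD⟩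
  rw [weilClassesField_prod_inf_divisorClassesSpan_eq_bot_of_odd hAB hBA hPm hPe hPirr hΨ her₁ her₂ hr₁ hk,
    Submodule.mem_bot] at h0
  exact hc0 h0

end Example

/-! ### §4 «If `W_F(X)` consists of Hodge classes»: exceptional Hodge classes on `A₁ × A₂` -/

section Hodge

/-- `e · 2m = 2 dim (A₁ × A₂)` from `e · rᵢ = 2 dim Aᵢ`, `r₁ + r₂ = 2m`. [folklore] -/
private theorem mul_two_mul_eq_two_mul_dim_prod (her₁ : e * r₁ = 2 * A₁.dim) (her₂ : e * r₂ = 2 * A₂.dim)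
    (hk : r₁ + r₂ = 2 * m) : e * (2 * m) = 2 * (A₁.prod A₂).dim := by
  rw [AbelianVariety.dim_prod, ← hk, mul_add, her₁, her₂, mul_add]

/-- **AN EXCEPTIONAL HODGE CLASS ON `A₁ × A₂`**: if moreover the multiplicities of `Ψ` are balanced (`n_ρ = n_ρ̄` at every
complex root of `P` — i.e. `W_F(A₁ × A₂) ⊗ ℂ` consists of Hodge classes, Moonen–Zarhin's standing assumption «if `W_F(X)`
consists of Hodge classes»), then `W_F(A₁ × A₂)` contains a non-zero RATIONAL class of Hodge type `(m, m)` which is not in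
`Dᵐ ⊗ ℂ` — an exceptional Hodge class («all non-zero elements of `W_F(X)` are exceptional Hodge classes.  Shioda's
example mentioned above is of this type»). [cite: MoonenZarhin1998WeilClasses, §2 Example (chunk p0002, lines 33–38)]
[cite: vanGeemen1994HodgeAV, 2.4–2.5] -/
theorem exists_isRationalClass_isOfHodgeType_not_mem_divisorClassesSpan_prod_of_odd (hAB : ∀ f : A₁ ⟶ A₂, f = 0)
    (hBA : ∀ g : A₂ ⟶ A₁, g = 0) (hPm : P.Monic) (hPe : P.natDegree = e)
    (hPirr : Irreducible (P.map (Int.castRingHom ℚ)))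
    (hΨ : Polynomial.eval₂ (Int.castRingHom (CategoryTheory.End (A₁.prod A₂)))
      (Ψ : CategoryTheory.End (A₁.prod A₂)) P = 0)
    (her₁ : e * r₁ = 2 * A₁.dim) (her₂ : e * r₂ = 2 * A₂.dim) (hr₁ : Odd r₁) (hk : r₁ + r₂ = 2 * m)
    (hbal : ∀ ρ : ℂ, Polynomial.eval₂ (Int.castRingHom ℂ) ρ P = 0 →
      eigenMultiplicity (A₁.prod A₂) Ψ ρ = eigenMultiplicity (A₁.prod A₂) Ψ (starRingEnd ℂ ρ)) :
    ∃ c ∈ weilClassesField (A₁.prod A₂) Ψ P (2 * m), IsRationalClass c ∧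
      IsOfHodgeType (A₁.prod A₂).dim (A₁.prod A₂).X (2 * m) m m c ∧ c ≠ 0 ∧
      c ∉ divisorClassesSpan (A₁.prod A₂).X (A₁.prod A₂).dim m := by
  have her := mul_two_mul_eq_two_mul_dim_prod her₁ her₂ hk
  obtain ⟨c, hcW, hcQ, hc0⟩ := exists_isRationalClass_ne_zero_mem_weilClassesField hPm hPe hPirr hΨ her
  have hcH := isOfHodgeType_of_mem_weilClassesField_of_balanced hPm hPe hPirr hΨ her hbal hcW
  rw [show 2 * m / 2 = m by omega] at hcH
  exact ⟨c, hcW, hcQ, hcH, hc0, not_mem_divisorClassesSpan_of_mem_weilClassesField_prod_of_odd hAB hBA hPm hPe hPirr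
    hΨ her₁ her₂ hr₁ hk hcW hc0⟩

/-- **«All non-zero elements of `W_F(X)` are exceptional Hodge classes»** (balanced multiplicities, `r₁` odd): every
non-zero class of `W_F(A₁ × A₂) ⊗ ℂ` is of Hodge type `(m, m)` and lies outside `Dᵐ ⊗ ℂ`.
[cite: MoonenZarhin1998WeilClasses, §2 Example (chunk p0002, lines 33–38)] -/
theorem forall_isOfHodgeType_and_not_mem_divisorClassesSpan_of_mem_weilClassesField_prod_of_odd
    (hAB : ∀ f : A₁ ⟶ A₂, f = 0) (hBA : ∀ g : A₂ ⟶ A₁, g = 0) (hPm : P.Monic) (hPe : P.natDegree = e)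
    (hPirr : Irreducible (P.map (Int.castRingHom ℚ)))
    (hΨ : Polynomial.eval₂ (Int.castRingHom (CategoryTheory.End (A₁.prod A₂)))
      (Ψ : CategoryTheory.End (A₁.prod A₂)) P = 0)
    (her₁ : e * r₁ = 2 * A₁.dim) (her₂ : e * r₂ = 2 * A₂.dim) (hr₁ : Odd r₁) (hk : r₁ + r₂ = 2 * m)
    (hbal : ∀ ρ : ℂ, Polynomial.eval₂ (Int.castRingHom ℂ) ρ P = 0 →
      eigenMultiplicity (A₁.prod A₂) Ψ ρ = eigenMultiplicity (A₁.prod A₂) Ψ (starRingEnd ℂ ρ)) :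
    ∀ c ∈ weilClassesField (A₁.prod A₂) Ψ P (2 * m), c ≠ 0 →
      IsOfHodgeType (A₁.prod A₂).dim (A₁.prod A₂).X (2 * m) m m c ∧
        c ∉ divisorClassesSpan (A₁.prod A₂).X (A₁.prod A₂).dim m := by
  intro c hcW hc0
  have her := mul_two_mul_eq_two_mul_dim_prod her₁ her₂ hk
  have hcH := isOfHodgeType_of_mem_weilClassesField_of_balanced hPm hPe hPirr hΨ her hbal hcW
  rw [show 2 * m / 2 = m by omega] at hcH
  exact ⟨hcH, not_mem_divisorClassesSpan_of_mem_weilClassesField_prod_of_odd hAB hBA hPm hPe hPirr hΨ her₁ her₂ hr₁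
    hk hcW hc0⟩

/-- **`[F:ℚ]` independent exceptional classes**: with balanced multiplicities and `r₁` odd,
`[F:ℚ] = e ≤ dim_ℂ Bᵐ(A₁ × A₂) ⊗ ℂ − dim_ℂ Dᵐ(A₁ × A₂) ⊗ ℂ` (`W_F ⊗ ℂ ⊆ Bᵐ ⊗ ℂ` has dimension `e` and meets
`Dᵐ ⊗ ℂ` in `0`; the tree's `natDegree_le_finrank_hodgeClassSpan_sub_finrank_divisorClassesSpan`).
[cite: MoonenZarhin1998WeilClasses, §2 Example and Introduction (the spaces W_k of exceptional classes)]
[cite: vanGeemen1994HodgeAV, 2.4–2.5, Thm. 6.12] -/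
theorem natDegree_le_finrank_hodgeClassSpan_sub_finrank_divisorClassesSpan_prod_of_odd
    (hAB : ∀ f : A₁ ⟶ A₂, f = 0) (hBA : ∀ g : A₂ ⟶ A₁, g = 0) (hPm : P.Monic) (hPe : P.natDegree = e)
    (hPirr : Irreducible (P.map (Int.castRingHom ℚ)))
    (hΨ : Polynomial.eval₂ (Int.castRingHom (CategoryTheory.End (A₁.prod A₂)))
      (Ψ : CategoryTheory.End (A₁.prod A₂)) P = 0)
    (her₁ : e * r₁ = 2 * A₁.dim) (her₂ : e * r₂ = 2 * A₂.dim) (hr₁ : Odd r₁) (hk : r₁ + r₂ = 2 * m)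
    (hbal : ∀ ρ : ℂ, Polynomial.eval₂ (Int.castRingHom ℂ) ρ P = 0 →
      eigenMultiplicity (A₁.prod A₂) Ψ ρ = eigenMultiplicity (A₁.prod A₂) Ψ (starRingEnd ℂ ρ)) :
    e ≤ finrank ℂ ↥(hodgeClassSpan (A₁.prod A₂).dim (A₁.prod A₂).X m) -
      finrank ℂ ↥(divisorClassesSpan (A₁.prod A₂).X (A₁.prod A₂).dim m) := by
  have her := mul_two_mul_eq_two_mul_dim_prod her₁ her₂ hk
  have hodd := Nat.odd_iff.1 hr₁
  have hm : m ≠ 0 := by omega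
  obtain ⟨c, hcW, -, -, -, hcD⟩ := exists_isRationalClass_isOfHodgeType_not_mem_divisorClassesSpan_prod_of_odd hAB hBA
    hPm hPe hPirr hΨ her₁ her₂ hr₁ hk hbal
  exact natDegree_le_finrank_hodgeClassSpan_sub_finrank_divisorClassesSpan hPm hPe hPirr hΨ her hm hbal hcW hcD

/-- **`B^•(A₁ × A₂) ≠ D^•(A₁ × A₂)`**: with balanced multiplicities and `r₁` odd, the product is NOT divisor-generated
(`IsDivisorGenerated`: every rational Hodge class of type `(p, p)` lies in `Dᵖ ⊗ ℂ`) — the exceptional Hodge class of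
§4 witnesses it. [cite: MoonenZarhin1998WeilClasses, §2 Example (chunk p0002, lines 33–38)] [cite: vanGeemen1994HodgeAV, 2.4–2.5] -/
theorem not_isDivisorGenerated_prod_of_odd (hAB : ∀ f : A₁ ⟶ A₂, f = 0) (hBA : ∀ g : A₂ ⟶ A₁, g = 0)
    (hPm : P.Monic) (hPe : P.natDegree = e) (hPirr : Irreducible (P.map (Int.castRingHom ℚ)))
    (hΨ : Polynomial.eval₂ (Int.castRingHom (CategoryTheory.End (A₁.prod A₂)))
      (Ψ : CategoryTheory.End (A₁.prod A₂)) P = 0)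
    (her₁ : e * r₁ = 2 * A₁.dim) (her₂ : e * r₂ = 2 * A₂.dim) (hr₁ : Odd r₁) (hk : r₁ + r₂ = 2 * m)
    (hbal : ∀ ρ : ℂ, Polynomial.eval₂ (Int.castRingHom ℂ) ρ P = 0 →
      eigenMultiplicity (A₁.prod A₂) Ψ ρ = eigenMultiplicity (A₁.prod A₂) Ψ (starRingEnd ℂ ρ)) :
    ¬ IsDivisorGenerated (A₁.prod A₂) := by
  obtain ⟨c, -, hcQ, hcH, -, hcD⟩ := exists_isRationalClass_isOfHodgeType_not_mem_divisorClassesSpan_prod_of_odd hAB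
    hBA hPm hPe hPirr hΨ her₁ her₂ hr₁ hk hbal
  exact fun hD => hcD (hD m c hcQ hcH)

end Hodge

end HodgeTheory

end Literature.AlgebraicGeometry.HodgeTheory

end
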